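import Literature.MathematicalPhysics.QuantumLattice.HubbardUVSymbolSmooth
import HarnessLib

/-!
# The ultraviolet symbol `w_Λ·c/(-iω+e)` as a smooth function of frequency AND band JOINTLY: all mixed partial derivatives
# `∂_ω^a ∂_e^m`, their envelopes `‖∂_ω^a∂_e^m Ψ‖ ≤ C_{a,m}(Λ)·c/m(ω)^{1+a+m}`, and the mixed differences of `Ψ(ω, e(s,t))`
# along a `C²` surface in the band variable

Topic `MathematicalPhysics/QuantumLattice`; continues `HubbardUVSymbolSmooth` (cell gate-hubbard-kl).  There the symbol of the covariance
ABOVE scale `Λ`, `Ψ_e(ω) = W(ω,e)·c/(-iω+e)` with `W = χ₂((ω²+e²)/Λ²)` (Salmhofer (4.70)), was differentiated twice in ONE variable at a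
time, with closed forms.  The first MOMENTS of the scale-`0` covariance in every space-time direction (Benfatto–Giuliani–Mastropietro
2006, Lemma 2.2: the `L¹` norm with a product weight `(1 + c₀|x₀|²)(1 + c₁|x₁|²)(1 + c₂|x₂|²)` is paid by the `ℓ²` norms of the MIXED
differences `Δ_ω^a Δ_{k₁}^b Δ_{k₂}^c` of the symbol) need the MIXED partials `∂_ω^a ∂_e^m Ψ` of total order up to `4`.  They are built
here WITHOUT closed forms on the transition shell: `Ψ = c·Ψ₁`, `Ψ₁(ω,e) = W·(-iω+e)⁻¹` is `C^∞` on `ℝ²` (it vanishes identically on the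
open disc `ω²+e² < Λ²/4`, and off the disc `ω²+e² ≤ Λ²/5` the denominator does not vanish), its partials
`Φ_{a,m} = ∂_e^m ∂_ω^a Ψ₁` (`uvMixedFn Λ a m`, iterated directional Fréchet derivatives) are `C^∞`, hence BOUNDED on the compact disc
`ω²+e² ≤ Λ²` (where `m(ω) = max(|ω|, Λ/2) ≤ Λ`), and OUTSIDE it `W ≡ 1` gives the closed form `Φ_{a,m} = i^a(-1)^m(a+m)!/(-iω+e)^{1+a+m}`
with `|-iω+e| ≥ m(ω)`.  Hence `‖Φ_{a,m}(ω,e)‖ ≤ C_{a,m}(Λ)/m(ω)^{1+a+m}` for ALL `a, m` with a constant depending on `Λ, a, m` only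
(`uvMixedConst`, the choice of an existential; for `(a,m) ∈ {(0,0),(0,1),(0,2),(2,0)}` `HubbardUVSymbolSmooth` has explicit ones).

* `partialFst`, `partialSnd` (directional derivatives on `ℝ × ℝ`), `contDiff_partialFst/Snd`, `hasDerivAt_partialFst/Snd`;
* `uvDenL` (`-iω+e` as a real-linear map), `uvSymbolOneFn` (`Ψ₁`), `uvSymbolFn_eq_mul_uvSymbolOneFn`, **`contDiff_uvSymbolOneFn`**;
* `uvMixedFn Λ a m`, `contDiff_uvMixedFn`, **`hasDerivAt_uvMixedFn_fst`**, **`hasDerivAt_uvMixedFn_snd`**, `uvMixedFn_eqOn_outer`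
  (closed form outside the disc), **`exists_norm_uvMixedFn_le`**, `uvMixedConst`, **`norm_uvMixedFn_le`**;
* the differences of `Ψ₁(ω, E(s,t))` along a surface in the band are in `HubbardUVSymbolSurfaceDifferences`.

Everything is proved; the functions and the constant are the only definitions; no named facts.

## Sources

M. Salmhofer, *Renormalization* (1999), §4.2.5 (4.70)–(4.71) (`Salmhofer1999`); G. Benfatto, A. Giuliani, V. Mastropietro,
Ann. Henri Poincaré 7 (2006) 809–898, §2.1 (2.3), Lemma 2.2, (2.36aa), App. A1 (`BenfattoGiulianiMastropietro2006`);
W. de Siqueira Pedra, M. Salmhofer, Comm. Math. Phys. 282 (2008) 797–818, §4 Cor. 4.4 (`PedraSalmhofer2008`).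
-/

noncomputable section

namespace Literature.MathematicalPhysics.QuantumLattice

open Literature.Probability.LatticeModels Set Complex Filter
open scoped _root_.Topology

/-! ### Directional derivatives of functions on `ℝ × ℝ` (frequency, band) -/

/-- `∂_ω f(x) := Df(x)·(1,0)`, the partial derivative in the first (frequency) variable. [cite: BenfattoGiulianiMastropietro2006, (2.36aa)] -/
def partialFst (f : ℝ × ℝ → ℂ) (x : ℝ × ℝ) : ℂ := fderiv ℝ f x (1, 0)

/-- `∂_e f(x) := Df(x)·(0,1)`, the partial derivative in the second (band) variable. [cite: BenfattoGiulianiMastropietro2006, (2.36aa)] -/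
def partialSnd (f : ℝ × ℝ → ℂ) (x : ℝ × ℝ) : ℂ := fderiv ℝ f x (0, 1)

section Partial

variable {f g : ℝ × ℝ → ℂ}

/-- `∂_ω` of a `C^∞` function is `C^∞`. [cite: BenfattoGiulianiMastropietro2006, (2.36aa)] -/
theorem contDiff_partialFst (hf : ContDiff ℝ (⊤ : ℕ∞) f) : ContDiff ℝ (⊤ : ℕ∞) (partialFst f) :=
  (contDiff_infty_iff_fderiv.1 hf).2.clm_apply contDiff_const

/-- `∂_e` of a `C^∞` function is `C^∞`. [cite: BenfattoGiulianiMastropietro2006, (2.36aa)] -/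
theorem contDiff_partialSnd (hf : ContDiff ℝ (⊤ : ℕ∞) f) : ContDiff ℝ (⊤ : ℕ∞) (partialSnd f) :=
  (contDiff_infty_iff_fderiv.1 hf).2.clm_apply contDiff_const

/-- Iterated `∂_ω` of a `C^∞` function is `C^∞`. [cite: BenfattoGiulianiMastropietro2006, (2.36aa)] -/
theorem contDiff_iterate_partialFst (hf : ContDiff ℝ (⊤ : ℕ∞) f) (n : ℕ) : ContDiff ℝ (⊤ : ℕ∞) (partialFst^[n] f) := by
  induction n with
  | zero => simpa using hf
  | succ n ih => rw [Function.iterate_succ_apply']; exact contDiff_partialFst ih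

/-- Iterated `∂_e` of a `C^∞` function is `C^∞`. [cite: BenfattoGiulianiMastropietro2006, (2.36aa)] -/
theorem contDiff_iterate_partialSnd (hf : ContDiff ℝ (⊤ : ℕ∞) f) (n : ℕ) : ContDiff ℝ (⊤ : ℕ∞) (partialSnd^[n] f) := by
  induction n with
  | zero => simpa using hf
  | succ n ih => rw [Function.iterate_succ_apply']; exact contDiff_partialSnd ih

/-- **`∂_ω f` is the derivative of the partial map** `ω ↦ f(ω, e)`. [cite: BenfattoGiulianiMastropietro2006, (2.36aa)] -/
theorem hasDerivAt_partialFst (hf : ContDiff ℝ (⊤ : ℕ∞) f) (ω e : ℝ) :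
    HasDerivAt (fun ω' => f (ω', e)) (partialFst f (ω, e)) ω := by
  have h1 : HasFDerivAt f (fderiv ℝ f (ω, e)) (ω, e) :=
    ((hf.differentiable (by simp)) (ω, e)).hasFDerivAt
  have h2 : HasDerivAt (fun ω' : ℝ => (ω', e)) ((1 : ℝ), (0 : ℝ)) ω :=
    (hasDerivAt_id ω).prodMk (hasDerivAt_const ω e)
  have h3 := HasFDerivAt.comp_hasDerivAt (f := fun ω' : ℝ => (ω', e)) (x := ω) h1 h2
  exact h3

/-- **`∂_e f` is the derivative of the partial map** `e ↦ f(ω, e)`. [cite: BenfattoGiulianiMastropietro2006, (2.36aa)] -/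
theorem hasDerivAt_partialSnd (hf : ContDiff ℝ (⊤ : ℕ∞) f) (ω e : ℝ) :
    HasDerivAt (fun e' => f (ω, e')) (partialSnd f (ω, e)) e := by
  have h1 : HasFDerivAt f (fderiv ℝ f (ω, e)) (ω, e) :=
    ((hf.differentiable (by simp)) (ω, e)).hasFDerivAt
  have h2 : HasDerivAt (fun e' : ℝ => (ω, e')) ((0 : ℝ), (1 : ℝ)) e :=
    (hasDerivAt_const e ω).prodMk (hasDerivAt_id e)
  have h3 := HasFDerivAt.comp_hasDerivAt (f := fun e' : ℝ => (ω, e')) (x := e) h1 h2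
  exact h3

/-- `∂_ω` only depends on the germ. [cite: BenfattoGiulianiMastropietro2006, (2.36aa)] -/
theorem partialFst_congr_of_eventuallyEq {x : ℝ × ℝ} (h : f =ᶠ[𝓝 x] g) : partialFst f x = partialFst g x := by
  simp only [partialFst, h.fderiv_eq]

/-- `∂_e` only depends on the germ. [cite: BenfattoGiulianiMastropietro2006, (2.36aa)] -/
theorem partialSnd_congr_of_eventuallyEq {x : ℝ × ℝ} (h : f =ᶠ[𝓝 x] g) : partialSnd f x = partialSnd g x := by
  simp only [partialSnd, h.fderiv_eq]

end Partial

/-! ### The denominator `-iω + e` as a real-linear map on `ℝ × ℝ` and the normalised symbol `Ψ₁ = W·(-iω+e)⁻¹` -/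

/-- `z(ω, e) = -iω + e`, a continuous `ℝ`-linear map `ℝ × ℝ → ℂ`. [cite: BenfattoGiulianiMastropietro2006, §2.1 (2.3)] -/
def uvDenL : ℝ × ℝ →L[ℝ] ℂ :=
  Complex.ofRealCLM.comp (ContinuousLinearMap.snd ℝ ℝ ℝ) - Complex.I • Complex.ofRealCLM.comp (ContinuousLinearMap.fst ℝ ℝ ℝ)

/-- `z(ω, e) = -iω + e`. [cite: BenfattoGiulianiMastropietro2006, §2.1 (2.3)] -/
theorem uvDenL_apply (x : ℝ × ℝ) : uvDenL x = -I * (x.1 : ℂ) + (x.2 : ℂ) := by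
  simp [uvDenL]; ring

/-- `z(ω, e)` is the denominator of `HubbardUVSymbolSmooth` (written there with `ω + 0`). [cite: BenfattoGiulianiMastropietro2006, §2.1 (2.3)] -/
theorem uvDenL_eq (ω e : ℝ) : uvDenL (ω, e) = -I * ((ω + 0 : ℝ) : ℂ) + (e : ℂ) := by
  rw [uvDenL_apply, add_zero]

/-- `‖z(ω,e)‖² = ω² + e²`. [cite: BenfattoGiulianiMastropietro2006, §2.1 (2.3)] -/
theorem norm_sq_uvDenL (x : ℝ × ℝ) : ‖uvDenL x‖ ^ 2 = x.1 ^ 2 + x.2 ^ 2 := by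
  rw [show x = (x.1, x.2) from rfl, uvDenL_eq]
  exact norm_sq_uvDen x.2 x.1

/-- `z(ω,e) ≠ 0` off the origin. [cite: BenfattoGiulianiMastropietro2006, §2.1 (2.3)] -/
theorem uvDenL_ne_zero {x : ℝ × ℝ} (h : 0 < x.1 ^ 2 + x.2 ^ 2) : uvDenL x ≠ 0 := by
  intro h0
  have h1 := norm_sq_uvDenL x
  rw [h0, norm_zero] at h1
  nlinarith

/-- On the closed shell `Λ²/4 ≤ ω²+e²`: `‖z(ω,e)‖ ≥ max(|ω|, Λ/2)`. [cite: BenfattoGiulianiMastropietro2006, §2.1 (2.3)] -/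
theorem max_le_norm_uvDenL {Λ : ℝ} (hΛ : 0 < Λ) {x : ℝ × ℝ} (h : Λ ^ 2 / 4 ≤ x.1 ^ 2 + x.2 ^ 2) :
    max |x.1| (Λ / 2) ≤ ‖uvDenL x‖ := by
  rw [show x = (x.1, x.2) from rfl, uvDenL_eq]
  exact max_le_norm_uvDen hΛ h

/-- **The normalised ultraviolet symbol** `Ψ₁(ω, e) = W(ω,e)·(-iω+e)⁻¹` on `ℝ × ℝ` (`c = 1`). [cite: Salmhofer1999, §4.2.5 (4.70)] -/
def uvSymbolOneFn (Λ : ℝ) (x : ℝ × ℝ) : ℂ := (uvWeightFn Λ x.2 x.1 : ℂ) * (uvDenL x)⁻¹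

/-- `Ψ_e(ω) = c·Ψ₁(ω, e)`. [cite: Salmhofer1999, §4.2.5 (4.70)] -/
theorem uvSymbolFn_eq_mul_uvSymbolOneFn (c Λ e ω : ℝ) : uvSymbolFn c Λ e ω = (c : ℂ) * uvSymbolOneFn Λ (ω, e) := by
  rw [uvSymbolFn, resolventFn, uvSymbolOneFn, uvDenL_eq, div_eq_mul_inv]
  ring

/-- The weight `(ω,e) ↦ W(ω,e)` is `C^∞` on `ℝ × ℝ` (as a complex-valued function). [cite: Salmhofer1999, §4.2.5 (4.71)] -/
theorem contDiff_uvWeight_prod (Λ : ℝ) : ContDiff ℝ (⊤ : ℕ∞) (fun x : ℝ × ℝ => (uvWeightFn Λ x.2 x.1 : ℂ)) := by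
  have h1 : ContDiff ℝ (⊤ : ℕ∞) (fun x : ℝ × ℝ => (x.1 ^ 2 + x.2 ^ 2) / Λ ^ 2) := by fun_prop
  have h2 : ContDiff ℝ (⊤ : ℕ∞) (fun x : ℝ × ℝ => uvWeightFn Λ x.2 x.1) := by
    unfold uvWeightFn
    exact (contDiff_salmhoferCutoff (n := ⊤)).comp h1
  exact Complex.ofRealCLM.contDiff.comp h2

/-- **`Ψ₁` is `C^∞` on `ℝ × ℝ`** (`0 < Λ`): off the disc `ω²+e² ≤ Λ²/5` the denominator does not vanish, inside `ω²+e² < Λ²/4`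
the weight vanishes identically. [cite: BenfattoGiulianiMastropietro2006, (2.36aa)] -/
theorem contDiff_uvSymbolOneFn {Λ : ℝ} (hΛ : 0 < Λ) : ContDiff ℝ (⊤ : ℕ∞) (uvSymbolOneFn Λ) := by
  refine contDiff_iff_contDiffAt.2 fun x => ?_
  by_cases h : Λ ^ 2 / 5 < x.1 ^ 2 + x.2 ^ 2
  · have hz : uvDenL x ≠ 0 := uvDenL_ne_zero (lt_trans (by positivity) h)
    have hW : ContDiffAt ℝ (⊤ : ℕ∞) (fun y : ℝ × ℝ => (uvWeightFn Λ y.2 y.1 : ℂ)) x := (contDiff_uvWeight_prod Λ).contDiffAt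
    have hR : ContDiffAt ℝ (⊤ : ℕ∞) (fun y : ℝ × ℝ => (uvDenL y)⁻¹) x := (uvDenL.contDiff.contDiffAt).inv hz
    exact hW.mul hR
  · have hlt : x.1 ^ 2 + x.2 ^ 2 < Λ ^ 2 / 4 := by linarith [not_lt.1 h, pow_pos hΛ 2]
    have hcont : Continuous fun y : ℝ × ℝ => y.1 ^ 2 + y.2 ^ 2 := by fun_prop
    have hopen : ∀ᶠ y in 𝓝 x, y.1 ^ 2 + y.2 ^ 2 < Λ ^ 2 / 4 := hcont.continuousAt.eventually_lt continuousAt_const hlt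
    have hev : uvSymbolOneFn Λ =ᶠ[𝓝 x] fun _ => (0 : ℂ) := by
      filter_upwards [hopen] with y hy
      rw [uvSymbolOneFn, (uvWeightFn_eq_zero_of_lt hΛ (e := y.2) (ω := y.1) hy).1, Complex.ofReal_zero, zero_mul]
    exact (contDiffAt_const (c := (0 : ℂ))).congr_of_eventuallyEq hev

/-! ### The mixed partials `Φ_{a,m} = ∂_e^m ∂_ω^a Ψ₁` -/

/-- **`Φ_{a,m} := ∂_e^m ∂_ω^a Ψ₁`** (first `a` frequency derivatives, then `m` band derivatives). [cite: BenfattoGiulianiMastropietro2006, (2.36aa)] -/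
def uvMixedFn (Λ : ℝ) (a m : ℕ) : ℝ × ℝ → ℂ := partialSnd^[m] (partialFst^[a] (uvSymbolOneFn Λ))

section Mixed

variable {Λ : ℝ}

/-- `Φ_{0,0} = Ψ₁`. [cite: Salmhofer1999, §4.2.5 (4.70)] -/
theorem uvMixedFn_zero_zero (Λ : ℝ) : uvMixedFn Λ 0 0 = uvSymbolOneFn Λ := rfl

/-- `Φ_{a+1,0} = ∂_ω Φ_{a,0}`. [cite: BenfattoGiulianiMastropietro2006, (2.36aa)] -/
theorem uvMixedFn_succ_zero (Λ : ℝ) (a : ℕ) : uvMixedFn Λ (a + 1) 0 = partialFst (uvMixedFn Λ a 0) := by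
  simp only [uvMixedFn, Function.iterate_zero, id_eq, Function.iterate_succ_apply']

/-- `Φ_{a,m+1} = ∂_e Φ_{a,m}`. [cite: BenfattoGiulianiMastropietro2006, (2.36aa)] -/
theorem uvMixedFn_succ (Λ : ℝ) (a m : ℕ) : uvMixedFn Λ a (m + 1) = partialSnd (uvMixedFn Λ a m) := by
  simp only [uvMixedFn, Function.iterate_succ_apply']

/-- Every `Φ_{a,m}` is `C^∞`. [cite: BenfattoGiulianiMastropietro2006, (2.36aa)] -/
theorem contDiff_uvMixedFn (hΛ : 0 < Λ) (a m : ℕ) : ContDiff ℝ (⊤ : ℕ∞) (uvMixedFn Λ a m) :=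
  contDiff_iterate_partialSnd (contDiff_iterate_partialFst (contDiff_uvSymbolOneFn hΛ) a) m

/-- Every `Φ_{a,m}` is continuous. [cite: BenfattoGiulianiMastropietro2006, (2.36aa)] -/
theorem continuous_uvMixedFn (hΛ : 0 < Λ) (a m : ℕ) : Continuous (uvMixedFn Λ a m) := (contDiff_uvMixedFn hΛ a m).continuous

/-- **`ω ↦ Φ_{a,0}(ω,e)` has derivative `Φ_{a+1,0}(ω,e)`.** [cite: BenfattoGiulianiMastropietro2006, (2.36aa)] -/
theorem hasDerivAt_uvMixedFn_fst (hΛ : 0 < Λ) (a : ℕ) (ω e : ℝ) :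
    HasDerivAt (fun ω' => uvMixedFn Λ a 0 (ω', e)) (uvMixedFn Λ (a + 1) 0 (ω, e)) ω := by
  rw [uvMixedFn_succ_zero]
  exact hasDerivAt_partialFst (contDiff_uvMixedFn hΛ a 0) ω e

/-- **`e ↦ Φ_{a,m}(ω,e)` has derivative `Φ_{a,m+1}(ω,e)`.** [cite: BenfattoGiulianiMastropietro2006, (2.36aa)] -/
theorem hasDerivAt_uvMixedFn_snd (hΛ : 0 < Λ) (a m : ℕ) (ω e : ℝ) :
    HasDerivAt (fun e' => uvMixedFn Λ a m (ω, e')) (uvMixedFn Λ a (m + 1) (ω, e)) e := by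
  rw [uvMixedFn_succ]
  exact hasDerivAt_partialSnd (contDiff_uvMixedFn hΛ a m) ω e

/-! ### Outside the disc `ω²+e² ≤ Λ²`: the closed form `Φ_{a,m} = i^a (-1)^m (a+m)! / (-iω+e)^{a+m+1}` -/

variable (Λ) in
/-- The region outside the disc, `Λ² < ω² + e²`, where `W ≡ 1`. [cite: Salmhofer1999, §4.2.5 (4.71)] -/
def uvOuter : Set (ℝ × ℝ) := {x | Λ ^ 2 < x.1 ^ 2 + x.2 ^ 2}

/-- The outer region is open. [cite: BenfattoGiulianiMastropietro2006, (2.36aa)] -/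
theorem isOpen_uvOuter (Λ : ℝ) : IsOpen (uvOuter Λ) := isOpen_lt continuous_const (by fun_prop)

/-- On the outer region the denominator does not vanish. [cite: BenfattoGiulianiMastropietro2006, §2.1 (2.3)] -/
theorem uvDenL_ne_zero_of_outer (hΛ : 0 < Λ) {x : ℝ × ℝ} (hx : x ∈ uvOuter Λ) : uvDenL x ≠ 0 :=
  uvDenL_ne_zero (lt_trans (pow_pos hΛ 2) hx)

/-- On the outer region `Ψ₁ = (-iω+e)⁻¹`. [cite: Salmhofer1999, §4.2.5 (4.71)] -/
theorem uvSymbolOneFn_eq_of_outer (hΛ : 0 < Λ) {x : ℝ × ℝ} (hx : x ∈ uvOuter Λ) : uvSymbolOneFn Λ x = (uvDenL x)⁻¹ := by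
  rw [uvSymbolOneFn, (uvWeightFn_eq_one_of_gt hΛ (e := x.2) (ω := x.1) hx).1, Complex.ofReal_one, one_mul]

/-- **`∂_ω (K/zⁿ⁺¹) = K·i(n+1)/zⁿ⁺²`** at a point where `z ≠ 0`. [cite: BenfattoGiulianiMastropietro2006, (2.36aa)] -/
theorem partialFst_const_mul_inv_pow (K : ℂ) (n : ℕ) {x : ℝ × ℝ} (hx : uvDenL x ≠ 0) :
    partialFst (fun y => K * ((uvDenL y) ^ (n + 1))⁻¹) x = K * (I * (n + 1)) * ((uvDenL x) ^ (n + 2))⁻¹ := by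
  have hw : (uvDenL x) ^ (n + 1) ≠ 0 := pow_ne_zero _ hx
  have h2 : HasDerivAt (fun w : ℂ => K * (w ^ (n + 1))⁻¹)
      (K * (-(((n + 1 : ℕ) : ℂ) * uvDenL x ^ (n + 1 - 1)) / ((uvDenL x) ^ (n + 1)) ^ 2)) (uvDenL x) :=
    ((hasDerivAt_pow (n + 1) (uvDenL x)).inv hw).const_mul K
  have h3 : HasFDerivAt (fun y : ℝ × ℝ => K * ((uvDenL y) ^ (n + 1))⁻¹)
      ((K * (-(((n + 1 : ℕ) : ℂ) * uvDenL x ^ (n + 1 - 1)) / ((uvDenL x) ^ (n + 1)) ^ 2)) • uvDenL) x :=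
    h2.comp_hasFDerivAt x uvDenL.hasFDerivAt
  rw [partialFst, h3.fderiv]
  have h10 : uvDenL ((1 : ℝ), (0 : ℝ)) = -I := by rw [uvDenL_apply]; simp
  simp only [_root_.smul_apply, smul_eq_mul, h10, Nat.add_sub_cancel]
  have h4 : (uvDenL x) ^ (n + 2) ≠ 0 := pow_ne_zero _ hx
  push_cast
  field_simp
  ring

/-- **`∂_e (K/zⁿ⁺¹) = -K(n+1)/zⁿ⁺²`** at a point where `z ≠ 0`. [cite: BenfattoGiulianiMastropietro2006, (2.36aa)] -/
theorem partialSnd_const_mul_inv_pow (K : ℂ) (n : ℕ) {x : ℝ × ℝ} (hx : uvDenL x ≠ 0) :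
    partialSnd (fun y => K * ((uvDenL y) ^ (n + 1))⁻¹) x = K * (-(n + 1)) * ((uvDenL x) ^ (n + 2))⁻¹ := by
  have hw : (uvDenL x) ^ (n + 1) ≠ 0 := pow_ne_zero _ hx
  have h2 : HasDerivAt (fun w : ℂ => K * (w ^ (n + 1))⁻¹)
      (K * (-(((n + 1 : ℕ) : ℂ) * uvDenL x ^ (n + 1 - 1)) / ((uvDenL x) ^ (n + 1)) ^ 2)) (uvDenL x) :=
    ((hasDerivAt_pow (n + 1) (uvDenL x)).inv hw).const_mul K
  have h3 : HasFDerivAt (fun y : ℝ × ℝ => K * ((uvDenL y) ^ (n + 1))⁻¹)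
      ((K * (-(((n + 1 : ℕ) : ℂ) * uvDenL x ^ (n + 1 - 1)) / ((uvDenL x) ^ (n + 1)) ^ 2)) • uvDenL) x :=
    h2.comp_hasFDerivAt x uvDenL.hasFDerivAt
  rw [partialSnd, h3.fderiv]
  have h10 : uvDenL ((0 : ℝ), (1 : ℝ)) = 1 := by rw [uvDenL_apply]; simp
  simp only [_root_.smul_apply, smul_eq_mul, h10, Nat.add_sub_cancel]
  have h4 : (uvDenL x) ^ (n + 2) ≠ 0 := pow_ne_zero _ hx
  push_cast
  field_simp
  ring

variable {f : ℝ × ℝ → ℂ}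

/-- One `∂_ω` on the outer region, for a function agreeing there with `K/zⁿ⁺¹`. [cite: BenfattoGiulianiMastropietro2006, (2.36aa)] -/
theorem eqOn_partialFst_of_eqOn (hΛ : 0 < Λ) {K : ℂ} {n : ℕ} (h : EqOn f (fun y => K * ((uvDenL y) ^ (n + 1))⁻¹) (uvOuter Λ)) :
    EqOn (partialFst f) (fun y => K * (I * (n + 1)) * ((uvDenL y) ^ (n + 2))⁻¹) (uvOuter Λ) := by
  intro x hx
  have hev : f =ᶠ[𝓝 x] fun y => K * ((uvDenL y) ^ (n + 1))⁻¹ := h.eventuallyEq_of_mem ((isOpen_uvOuter Λ).mem_nhds hx)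
  rw [partialFst_congr_of_eventuallyEq hev]
  exact partialFst_const_mul_inv_pow K n (uvDenL_ne_zero_of_outer hΛ hx)

/-- One `∂_e` on the outer region, for a function agreeing there with `K/zⁿ⁺¹`. [cite: BenfattoGiulianiMastropietro2006, (2.36aa)] -/
theorem eqOn_partialSnd_of_eqOn (hΛ : 0 < Λ) {K : ℂ} {n : ℕ} (h : EqOn f (fun y => K * ((uvDenL y) ^ (n + 1))⁻¹) (uvOuter Λ)) :
    EqOn (partialSnd f) (fun y => K * (-(n + 1)) * ((uvDenL y) ^ (n + 2))⁻¹) (uvOuter Λ) := by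
  intro x hx
  have hev : f =ᶠ[𝓝 x] fun y => K * ((uvDenL y) ^ (n + 1))⁻¹ := h.eventuallyEq_of_mem ((isOpen_uvOuter Λ).mem_nhds hx)
  rw [partialSnd_congr_of_eventuallyEq hev]
  exact partialSnd_const_mul_inv_pow K n (uvDenL_ne_zero_of_outer hΛ hx)

/-- `Φ_{a,0} = i^a a!/z^{a+1}` outside the disc. [cite: BenfattoGiulianiMastropietro2006, (2.36aa)] -/
theorem uvMixedFn_eqOn_outer_fst (hΛ : 0 < Λ) (a : ℕ) :
    EqOn (uvMixedFn Λ a 0) (fun y => (I ^ a * (a.factorial : ℂ)) * ((uvDenL y) ^ (a + 1))⁻¹) (uvOuter Λ) := by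
  induction a with
  | zero =>
    intro x hx
    simp [uvMixedFn_zero_zero, uvSymbolOneFn_eq_of_outer hΛ hx]
  | succ a ih =>
    rw [uvMixedFn_succ_zero]
    intro x hx
    rw [eqOn_partialFst_of_eqOn hΛ ih hx]
    push_cast [Nat.factorial_succ]
    ring

/-- **`Φ_{a,m} = i^a (-1)^m (a+m)!/z^{a+m+1}` outside the disc.** [cite: BenfattoGiulianiMastropietro2006, (2.36aa)] -/
theorem uvMixedFn_eqOn_outer (hΛ : 0 < Λ) (a m : ℕ) :
    EqOn (uvMixedFn Λ a m) (fun y => (I ^ a * (-1) ^ m * ((a + m).factorial : ℂ)) * ((uvDenL y) ^ (a + m + 1))⁻¹) (uvOuter Λ) := by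
  induction m with
  | zero =>
    intro x hx
    rw [uvMixedFn_eqOn_outer_fst hΛ a hx]
    simp
  | succ m ih =>
    rw [uvMixedFn_succ]
    intro x hx
    rw [eqOn_partialSnd_of_eqOn hΛ ih hx]
    rw [show a + (m + 1) = (a + m) + 1 by ring]
    push_cast [Nat.factorial_succ]
    ring

/-- The norm of the closed form: `‖Φ_{a,m}(ω,e)‖ = (a+m)!/‖-iω+e‖^{a+m+1}` outside the disc. [cite: BenfattoGiulianiMastropietro2006, (2.36aa)] -/
theorem norm_uvMixedFn_of_outer (hΛ : 0 < Λ) (a m : ℕ) {x : ℝ × ℝ} (hx : x ∈ uvOuter Λ) :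
    ‖uvMixedFn Λ a m x‖ = (a + m).factorial / ‖uvDenL x‖ ^ (a + m + 1) := by
  rw [uvMixedFn_eqOn_outer hΛ a m hx]
  simp [norm_pow, norm_inv, norm_neg, Complex.norm_I, div_eq_mul_inv]

/-! ### The envelope `‖Φ_{a,m}(ω,e)‖ ≤ C_{a,m}(Λ)/max(|ω|, Λ/2)^{a+m+1}` -/

/-- On the compact disc `ω²+e² ≤ Λ²` every `Φ_{a,m}` is bounded (it is continuous). [cite: BenfattoGiulianiMastropietro2006, (2.36aa)] -/
theorem exists_bound_uvMixedFn_disc (hΛ : 0 < Λ) (a m : ℕ) :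
    ∃ K : ℝ, 0 ≤ K ∧ ∀ x : ℝ × ℝ, x.1 ^ 2 + x.2 ^ 2 ≤ Λ ^ 2 → ‖uvMixedFn Λ a m x‖ ≤ K := by
  obtain ⟨K, hK⟩ := (isCompact_closedBall (0 : ℝ × ℝ) Λ).exists_bound_of_continuousOn
    ((continuous_uvMixedFn hΛ a m).continuousOn)
  refine ⟨max K 0, le_max_right _ _, fun x hx => (hK x ?_).trans (le_max_left _ _)⟩
  rw [Metric.mem_closedBall, dist_zero_right, Prod.norm_def, Real.norm_eq_abs, Real.norm_eq_abs]
  exact max_le (abs_le.2 (abs_le_of_sq_le_sq' (by nlinarith [sq_nonneg x.2]) hΛ.le))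
    (abs_le.2 (abs_le_of_sq_le_sq' (by nlinarith [sq_nonneg x.1]) hΛ.le))

/-- **The envelope of the mixed partials**: for every `a, m` there is `C ≥ 0` (depending on `Λ, a, m` only) with
`‖Φ_{a,m}(ω,e)‖ ≤ C/max(|ω|, Λ/2)^{a+m+1}` for all `ω, e` — on the disc `ω²+e² ≤ Λ²` by compactness (`max(|ω|,Λ/2) ≤ Λ` there),
outside by the closed form (`‖-iω+e‖ ≥ max(|ω|, Λ/2)`). [cite: BenfattoGiulianiMastropietro2006, (2.36aa)] -/
theorem exists_norm_uvMixedFn_le (hΛ : 0 < Λ) (a m : ℕ) :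
    ∃ C : ℝ, 0 ≤ C ∧ ∀ x : ℝ × ℝ, ‖uvMixedFn Λ a m x‖ ≤ C / max |x.1| (Λ / 2) ^ (a + m + 1) := by
  obtain ⟨K, hK0, hK⟩ := exists_bound_uvMixedFn_disc hΛ a m
  refine ⟨K * Λ ^ (a + m + 1) + (a + m).factorial, by positivity, fun x => ?_⟩
  have hm := uvEnv_pos hΛ x.1
  have hfac : (0 : ℝ) ≤ (a + m).factorial := by positivity
  by_cases hx : x.1 ^ 2 + x.2 ^ 2 ≤ Λ ^ 2
  · have henv : max |x.1| (Λ / 2) ≤ Λ := uvEnv_le_of_le hΛ hx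
    calc ‖uvMixedFn Λ a m x‖ ≤ K := hK x hx
      _ = K * Λ ^ (a + m + 1) / Λ ^ (a + m + 1) := by field_simp
      _ ≤ K * Λ ^ (a + m + 1) / max |x.1| (Λ / 2) ^ (a + m + 1) :=
          div_le_div_of_nonneg_left (by positivity) (pow_pos hm _) (pow_le_pow_left₀ hm.le henv _)
      _ ≤ (K * Λ ^ (a + m + 1) + (a + m).factorial) / max |x.1| (Λ / 2) ^ (a + m + 1) := by
          gcongr; linarith
  · have hxo : x ∈ uvOuter Λ := not_le.1 hx
    have hden : max |x.1| (Λ / 2) ≤ ‖uvDenL x‖ := max_le_norm_uvDenL hΛ (by linarith [not_le.1 hx, pow_pos hΛ 2])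
    rw [norm_uvMixedFn_of_outer hΛ a m hxo]
    calc ((a + m).factorial : ℝ) / ‖uvDenL x‖ ^ (a + m + 1) ≤ (a + m).factorial / max |x.1| (Λ / 2) ^ (a + m + 1) :=
          div_le_div_of_nonneg_left hfac (pow_pos hm _) (pow_le_pow_left₀ hm.le hden _)
      _ ≤ (K * Λ ^ (a + m + 1) + (a + m).factorial) / max |x.1| (Λ / 2) ^ (a + m + 1) := by
          gcongr; nlinarith [pow_pos hΛ (a + m + 1)]

variable (Λ) in
/-- **The envelope constant `C_{a,m}(Λ)`** of `‖∂_e^m∂_ω^a Ψ₁‖ ≤ C_{a,m}(Λ)/max(|ω|,Λ/2)^{a+m+1}` (a choice; depends on `Λ, a, m` only;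
`0` for `Λ ≤ 0`). [cite: BenfattoGiulianiMastropietro2006, (2.36aa)] -/
def uvMixedConst (a m : ℕ) : ℝ := if h : 0 < Λ then Classical.choose (exists_norm_uvMixedFn_le h a m) else 0

/-- `C_{a,m}(Λ) ≥ 0`. [cite: BenfattoGiulianiMastropietro2006, (2.36aa)] -/
theorem uvMixedConst_nonneg (Λ : ℝ) (a m : ℕ) : 0 ≤ uvMixedConst Λ a m := by
  unfold uvMixedConst
  split_ifs with h
  · exact (Classical.choose_spec (exists_norm_uvMixedFn_le h a m)).1
  · exact le_rfl

/-- **`‖Φ_{a,m}(ω,e)‖ ≤ C_{a,m}(Λ)/max(|ω|, Λ/2)^{a+m+1}`** for all `ω, e` (`0 < Λ`). [cite: BenfattoGiulianiMastropietro2006, (2.36aa)] -/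
theorem norm_uvMixedFn_le (hΛ : 0 < Λ) (a m : ℕ) (ω e : ℝ) :
    ‖uvMixedFn Λ a m (ω, e)‖ ≤ uvMixedConst Λ a m / max |ω| (Λ / 2) ^ (a + m + 1) := by
  have h := (Classical.choose_spec (exists_norm_uvMixedFn_le hΛ a m)).2 (ω, e)
  unfold uvMixedConst
  rw [dif_pos hΛ]
  exact h

/-- In the original normalisation: `‖Ψ_e(ω)‖`-type bound `‖c·Φ_{a,m}(ω,e)‖ ≤ C_{a,m}(Λ)·c/max(|ω|,Λ/2)^{a+m+1}` (`c ≥ 0`).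
[cite: BenfattoGiulianiMastropietro2006, (2.36aa)] -/
theorem norm_mul_uvMixedFn_le (hΛ : 0 < Λ) {c : ℝ} (hc : 0 ≤ c) (a m : ℕ) (ω e : ℝ) :
    ‖(c : ℂ) * uvMixedFn Λ a m (ω, e)‖ ≤ uvMixedConst Λ a m * c / max |ω| (Λ / 2) ^ (a + m + 1) := by
  rw [norm_mul, Complex.norm_real, Real.norm_eq_abs, abs_of_nonneg hc]
  calc c * ‖uvMixedFn Λ a m (ω, e)‖ ≤ c * (uvMixedConst Λ a m / max |ω| (Λ / 2) ^ (a + m + 1)) :=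
        mul_le_mul_of_nonneg_left (norm_uvMixedFn_le hΛ a m ω e) hc
    _ = uvMixedConst Λ a m * c / max |ω| (Λ / 2) ^ (a + m + 1) := by ring

end Mixed

end Literature.MathematicalPhysics.QuantumLattice

end
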